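import Mathlib.Algebra.Order.Ring.Int
import Mathlib.Algebra.Group.Int.Even
import Mathlib.Analysis.Complex.Basic
import HarnessLib

/-!
# The Peano lattice and the Manhattan orientation ([LSW04] §4.1)

G. F. Lawler, O. Schramm, W. Werner, *Conformal invariance of planar loop-erased random walks and
uniform spanning trees*, Ann. Probab. **32** (2004) 939–995 (**[LSW04]**), §4.1 "Setup"
(pp. 969–971), sets up the combinatorics of the **uniform spanning tree (UST) Peano curve**:

> "If a tree `T` lies in the grid `ℤ²`, then its dual tree `T†` will lie in the dual grid
> `(ℤ + 1/2)²`, and the Peano path `γ` will lie in the graph `G` whose vertices are `(1/4 + ℤ/2)²`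
> and where `v, u` neighbor iff `|v - u| = 1/2`. … elements of `ℤ²` are the primal vertices,
> elements of `(1/2 + ℤ)²` are the dual vertices and elements of `(1/4 + ℤ/2)²` are the Peano
> vertices. If `w, v` are vertices of any kind, we say that they are adjacent if the distance
> between them is as small as it can be for distinct vertices of these particular kinds." (p. 970)

> "We orient the edges of `G` by specifying that the square faces of `G` containing a primal
> vertex are oriented clockwise, while those containing a dual vertex are oriented
> counterclockwise. … `G⃗` is often called the Manhattan lattice." (p. 971)

This file (no topology, no probability):

* lattice points `primalPt`, `dualPt`, `peanoPt : ℤ × ℤ → ℂ` (indexing `(m, n) ↦ m + n i`,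
  `(m + 1/2) + (n + 1/2) i`, `(1/4 + m/2) + (1/4 + n/2) i`), nearest-neighbour adjacency
  `LatticeAdj` on `ℤ²` (primal–primal and, through `dualPt`, dual–dual adjacency);
* the primal / dual vertex adjacent to a Peano vertex (`primalNbr`, `dualNbr`): each Peano
  vertex is adjacent (`‖·‖_∞ = 1/4`) to exactly ONE primal and ONE dual vertex
  (`abs_re_peanoPt_sub_primalPt`, `abs_re_peanoPt_sub_dualPt`), and is the midpoint of the
  segment joining them (`peanoPt_eq_midpoint`) — these are `α_a, β_a` for `a`, and `[α_a, β_a]`;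
* the **Manhattan orientation** `Manhattan p q` of the Peano graph (the row `y = 1/4 + j/2` is
  directed towards `+x` iff `j` is even, the column `x = 1/4 + i/2` towards `+y` iff `i` is odd —
  this is the clockwise/counterclockwise rule, checked in the docstring of `Manhattan`), with
  `manhattan_iff` (out-degree two: one horizontal and one vertical edge leave every vertex).

The domains `D(α, β, a, b)` are in `USTPeanoDomain.lean`, the Peano paths and the UST law in
`USTPeanoPath.lean`.
-/

noncomputable section

open Set Function Complex

namespace Literature.Probability.RandomPlanarGeometry

namespace USTPeano

/-! ### The three lattices -/

/-- The **primal vertex** `(m, n) ∈ ℤ²` as a point of `ℂ`. [LSW04] §4.1, p. 970.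
[cite: LawlerSchrammWerner2004, §4.1] -/
def primalPt (v : ℤ × ℤ) : ℂ := ⟨v.1, v.2⟩

/-- The **dual vertex** `(m + 1/2, n + 1/2) ∈ (1/2 + ℤ)²` indexed by `(m, n)`. [LSW04] §4.1,
p. 970. [cite: LawlerSchrammWerner2004, §4.1] -/
def dualPt (v : ℤ × ℤ) : ℂ := ⟨v.1 + 1 / 2, v.2 + 1 / 2⟩

/-- The **Peano vertex** `(1/4 + i/2, 1/4 + j/2) ∈ (1/4 + ℤ/2)²` indexed by `(i, j)`. [LSW04]
§4.1, p. 970. [cite: LawlerSchrammWerner2004, §4.1] -/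
def peanoPt (v : ℤ × ℤ) : ℂ := ⟨v.1 / 2 + 1 / 4, v.2 / 2 + 1 / 4⟩

/-- Real part of a primal vertex. [folklore] -/
@[simp] theorem primalPt_re (v : ℤ × ℤ) : (primalPt v).re = v.1 := rfl

/-- Imaginary part of a primal vertex. [folklore] -/
@[simp] theorem primalPt_im (v : ℤ × ℤ) : (primalPt v).im = v.2 := rfl

/-- Real part of a dual vertex. [folklore] -/
@[simp] theorem dualPt_re (v : ℤ × ℤ) : (dualPt v).re = v.1 + 1 / 2 := rfl

/-- Imaginary part of a dual vertex. [folklore] -/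
@[simp] theorem dualPt_im (v : ℤ × ℤ) : (dualPt v).im = v.2 + 1 / 2 := rfl

/-- Real part of a Peano vertex. [folklore] -/
@[simp] theorem peanoPt_re (v : ℤ × ℤ) : (peanoPt v).re = v.1 / 2 + 1 / 4 := rfl

/-- Imaginary part of a Peano vertex. [folklore] -/
@[simp] theorem peanoPt_im (v : ℤ × ℤ) : (peanoPt v).im = v.2 / 2 + 1 / 4 := rfl

/-- Distinct indices give distinct primal vertices. [folklore] -/
theorem primalPt_injective : Injective primalPt := by
  rintro ⟨m, n⟩ ⟨m', n'⟩ h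
  have h1 := congrArg Complex.re h
  have h2 := congrArg Complex.im h
  simp only [primalPt_re, primalPt_im, Int.cast_inj] at h1 h2
  simp [h1, h2]

/-- Distinct indices give distinct dual vertices. [folklore] -/
theorem dualPt_injective : Injective dualPt := by
  rintro ⟨m, n⟩ ⟨m', n'⟩ h
  have h1 := congrArg Complex.re h
  have h2 := congrArg Complex.im h
  simp only [dualPt_re, dualPt_im, add_left_inj, Int.cast_inj] at h1 h2
  simp [h1, h2]

/-- Distinct indices give distinct Peano vertices. [folklore] -/
theorem peanoPt_injective : Injective peanoPt := by
  rintro ⟨m, n⟩ ⟨m', n'⟩ h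
  have h1 := congrArg Complex.re h
  have h2 := congrArg Complex.im h
  simp only [peanoPt_re, peanoPt_im, add_left_inj] at h1 h2
  have h1' : (m : ℝ) = m' := by linarith
  have h2' : (n : ℝ) = n' := by linarith
  simp [Int.cast_inj.1 h1', Int.cast_inj.1 h2']

/-- **Nearest-neighbour adjacency in `ℤ²`** (used for the primal grid and, through `dualPt`, for
the dual grid): the two sites differ by a unit coordinate vector. [LSW04] §4.1, p. 970
("if they are of the same kind, this means that they are neighbors"). [cite: LawlerSchrammWerner2004, §4.1] -/
def LatticeAdj (u v : ℤ × ℤ) : Prop :=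
  (u.1 = v.1 ∧ (u.2 + 1 = v.2 ∨ v.2 + 1 = u.2)) ∨ (u.2 = v.2 ∧ (u.1 + 1 = v.1 ∨ v.1 + 1 = u.1))

/-- Lattice adjacency is decidable. [folklore] -/
instance : DecidableRel LatticeAdj := fun u v ↦ by
  unfold LatticeAdj; infer_instance

/-- Lattice adjacency is symmetric. [folklore] -/
theorem LatticeAdj.symm {u v : ℤ × ℤ} (h : LatticeAdj u v) : LatticeAdj v u := by
  unfold LatticeAdj at h ⊢
  tauto

/-- Adjacent primal vertices are at distance `1`. [folklore] -/
theorem dist_primalPt_of_latticeAdj {u v : ℤ × ℤ} (h : LatticeAdj u v) :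
    dist (primalPt u) (primalPt v) = 1 := by
  rw [Complex.dist_eq, Complex.norm_def, Complex.normSq_apply]
  rcases h with ⟨h1, h2 | h2⟩ | ⟨h1, h2 | h2⟩ <;>
  · simp only [Complex.sub_re, Complex.sub_im, primalPt_re, primalPt_im, h1, ← h2]
    push_cast
    norm_num

/-- **The primal vertex adjacent to the Peano vertex `p`**: the unique `v ∈ ℤ²` with
`‖peanoPt p - primalPt v‖_∞ = 1/4` ([LSW04] p. 970: "if `v ∈ (1/4 + ℤ/2)²` and `w ∈ ℤ²`, [adjacent]
means `‖v - w‖_∞ = 1/4`"); in coordinates `v = (⌈i/2⌉, ⌈j/2⌉)`. This is `α_a` for `p = a`.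
[cite: LawlerSchrammWerner2004, §4.1] -/
def primalNbr (p : ℤ × ℤ) : ℤ × ℤ := ((p.1 + 1) / 2, (p.2 + 1) / 2)

/-- **The dual vertex adjacent to the Peano vertex `p`**: the unique dual vertex `w` with
`‖peanoPt p - w‖_∞ = 1/4`, namely `dualPt (⌊i/2⌋, ⌊j/2⌋)`. This is `β_a` for `p = a`.
[cite: LawlerSchrammWerner2004, §4.1] -/
def dualNbr (p : ℤ × ℤ) : ℤ × ℤ := (p.1 / 2, p.2 / 2)

/-- Coordinate computation: `i/2 + 1/4 - ⌈i/2⌉ = ± 1/4` according to the parity of `i`. [folklore] -/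
theorem half_add_quarter_sub_primal (i : ℤ) :
    (i : ℝ) / 2 + 1 / 4 - (((i + 1) / 2 : ℤ) : ℝ) = if Even i then 1 / 4 else -(1 / 4) := by
  rcases Int.even_or_odd i with ⟨k, rfl⟩ | ⟨k, rfl⟩
  · have : (k + k + 1) / 2 = k := by omega
    rw [this, if_pos ⟨k, rfl⟩]
    push_cast
    ring
  · have : (2 * k + 1 + 1) / 2 = k + 1 := by omega
    rw [this, if_neg (Int.not_even_iff_odd.2 ⟨k, rfl⟩)]
    push_cast
    ring

/-- Coordinate computation: `i/2 + 1/4 - (⌊i/2⌋ + 1/2) = ∓ 1/4` according to the parity of `i`.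
[folklore] -/
theorem half_add_quarter_sub_dual (i : ℤ) :
    (i : ℝ) / 2 + 1 / 4 - (((i / 2 : ℤ) : ℝ) + 1 / 2) = if Even i then -(1 / 4) else 1 / 4 := by
  rcases Int.even_or_odd i with ⟨k, rfl⟩ | ⟨k, rfl⟩
  · have : (k + k) / 2 = k := by omega
    rw [this, if_pos ⟨k, rfl⟩]
    push_cast
    ring
  · have : (2 * k + 1) / 2 = k := by omega
    rw [this, if_neg (Int.not_even_iff_odd.2 ⟨k, rfl⟩)]
    push_cast
    ring

/-- The Peano vertex `p` is adjacent to `primalNbr p`: both coordinates differ by `1/4` in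
absolute value (`‖·‖_∞ = 1/4`). [LSW04] p. 970. [cite: LawlerSchrammWerner2004, §4.1] -/
theorem abs_re_peanoPt_sub_primalPt (p : ℤ × ℤ) :
    |(peanoPt p - primalPt (primalNbr p)).re| = 1 / 4 ∧
      |(peanoPt p - primalPt (primalNbr p)).im| = 1 / 4 := by
  simp only [Complex.sub_re, Complex.sub_im, peanoPt_re, peanoPt_im, primalPt_re, primalPt_im,
    primalNbr, half_add_quarter_sub_primal]
  constructor <;> split_ifs <;> norm_num

/-- The Peano vertex `p` is adjacent to the dual vertex `dualPt (dualNbr p)`: both coordinates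
differ by `1/4` in absolute value. [LSW04] p. 970. [cite: LawlerSchrammWerner2004, §4.1] -/
theorem abs_re_peanoPt_sub_dualPt (p : ℤ × ℤ) :
    |(peanoPt p - dualPt (dualNbr p)).re| = 1 / 4 ∧
      |(peanoPt p - dualPt (dualNbr p)).im| = 1 / 4 := by
  simp only [Complex.sub_re, Complex.sub_im, peanoPt_re, peanoPt_im, dualPt_re, dualPt_im,
    dualNbr, half_add_quarter_sub_dual]
  constructor <;> split_ifs <;> norm_num

/-- The Peano vertex `p` is the midpoint of the segment `[primalNbr p, dualNbr p]` ([LSW04]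
p. 970: "the line segment `[α_a, β_a]` has `a` as its midpoint"). [cite: LawlerSchrammWerner2004, §4.1] -/
theorem peanoPt_eq_midpoint (p : ℤ × ℤ) :
    peanoPt p = (1 / 2 : ℂ) * (primalPt (primalNbr p) + dualPt (dualNbr p)) := by
  apply Complex.ext
  · have h1 := half_add_quarter_sub_primal p.1
    have h2 := half_add_quarter_sub_dual p.1
    simp only [peanoPt_re, Complex.mul_re, Complex.add_re, Complex.add_im, primalPt_re,
      dualPt_re, primalNbr, dualNbr]
    split_ifs at h1 h2 <;> norm_num at h1 h2 ⊢ <;> linarith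
  · have h1 := half_add_quarter_sub_primal p.2
    have h2 := half_add_quarter_sub_dual p.2
    simp only [peanoPt_im, Complex.mul_im, Complex.add_re, Complex.add_im, primalPt_im,
      dualPt_im, primalNbr, dualNbr]
    split_ifs at h1 h2 <;> norm_num at h1 h2 ⊢ <;> linarith

/-! ### The Manhattan orientation of the Peano graph -/

/-- **The Manhattan orientation** `G⃗` of the Peano graph ([LSW04] p. 971): `Manhattan p q` iff
`q` is a neighbour of `p` (`|peanoPt p - peanoPt q| = 1/2`) and the edge `p → q` has the
orientation in which the square faces of `G` around primal vertices are traversed clockwise and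
those around dual vertices counterclockwise. In coordinates `p = (i, j)` (`peanoPt p =
(1/4 + i/2, 1/4 + j/2)`): the row through `p` is directed towards `+x` iff `j` is even, and the
column through `p` towards `+y` iff `i` is odd. (Check: the face of `G` with corners
`(±1/4, ±1/4)` surrounds the primal vertex `0`; clockwise means its top edge, in the row `j = 0`,
runs `(-1/4, 1/4) → (1/4, 1/4)`, i.e. towards `+x`, and its left edge, in the column `i = -1`,
runs upwards; "consecutive parallel lines get opposite orientations" (p. 971).)
[cite: LawlerSchrammWerner2004, §4.1] -/
def Manhattan (p q : ℤ × ℤ) : Prop :=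
  (q = (p.1 + 1, p.2) ∧ Even p.2) ∨ (q = (p.1 - 1, p.2) ∧ Odd p.2) ∨
    (q = (p.1, p.2 + 1) ∧ Odd p.1) ∨ (q = (p.1, p.2 - 1) ∧ Even p.1)

/-- The Manhattan relation is decidable. [folklore] -/
instance : DecidableRel Manhattan := fun p q ↦ by
  unfold Manhattan; infer_instance

/-- A Manhattan step joins neighbouring Peano vertices (distance `1/2`). [LSW04] p. 970.
[cite: LawlerSchrammWerner2004, §4.1] -/
theorem dist_peanoPt_of_manhattan {p q : ℤ × ℤ} (h : Manhattan p q) :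
    dist (peanoPt p) (peanoPt q) = 1 / 2 := by
  rw [Complex.dist_eq, Complex.norm_def, Complex.normSq_apply]
  rcases h with ⟨rfl, -⟩ | ⟨rfl, -⟩ | ⟨rfl, -⟩ | ⟨rfl, -⟩ <;>
  · simp only [Complex.sub_re, Complex.sub_im, peanoPt_re, peanoPt_im]
    push_cast
    ring_nf
    rw [show (1 / 4 : ℝ) = (1 / 2) * (1 / 2) by norm_num, Real.sqrt_mul_self (by norm_num)]

/-- **Out-degree two**: from every Peano vertex there are exactly two Manhattan edges, one
horizontal and one vertical ([LSW04] p. 971: "there are precisely two oriented edges of `G⃗` with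
initial point `v`"). [cite: LawlerSchrammWerner2004, §4.1] -/
theorem manhattan_iff (p q : ℤ × ℤ) :
    Manhattan p q ↔
      q = (if Even p.2 then (p.1 + 1, p.2) else (p.1 - 1, p.2)) ∨
        q = (if Even p.1 then (p.1, p.2 - 1) else (p.1, p.2 + 1)) := by
  simp only [Manhattan, ← Int.not_even_iff_odd]
  by_cases h1 : Even p.1 <;> by_cases h2 : Even p.2 <;> simp [h1, h2]

end USTPeano

end Literature.Probability.RandomPlanarGeometry
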